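import Mathlib
import HarnessLib

/-!
# Every feed-recurrent set of sources of a KP network proper carries a primary mode
# (helper file for the crux `SubOnsagerCeiling.ForwardTailCeilingKP`, stmt-NavierStokesRegularity-27057, `--supports`;
# companion of `Theorems/SubOnsagerCeilingKPNetRealization.lean`)

The registered stubs `stub_primaryGradedLargeRatio` / `stub_primaryGradedSmallRatio` (LEAD skeleton
`Cruxes/ForwardTailCeilingKP/Lines/kp_shell_barrier.lean`) promise, for every KP network proper, SOME grading `lev` of the modes
satisfying the structural clauses `GradedStruct α lev` together with a ν-uniform super-critical shell barrier for the modes of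
level `0`.  Which modes does that bind?  `Theorems.kpNet_selfFeed_primary` / `kpNet_twoCycle_primary` (companion file): self-fed
modes and feed 2-cycles are level `0` in EVERY such grading.  Here, def-free and for the clauses verbatim:

* `kpNet_recurrent_has_primary` — every non-empty set `C` of forward sources each of which is fed (diagonally) by a member of `C`
  (a feed cycle of any length, a strongly connected component of the feed graph, a multi-reach pump/feed loop) contains a mode of
  level `0` in every structural grading (the member of minimal level versus clause (1));
* `kpNet_threeCycle_has_primary` — the case `C = {a, b, c}`; the docstring records that the bare 3-cycle admits the grading
  `(2, 0, 1)`, so — unlike the 2-cycle — not every member is forced.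

So the stubs assert, BY NAME, the barrier on at least one mode of every recurrent sub-network of every table; along a self-similar
front all modes of a recurrent loop share one peak exponent, hence the stubs contain the front-exponent bound `θ_f > 1/2` for every
recurrent architecture (the numerics of this hand: multi-reach loops reach `θ_f ≈ 0.55` with four modes at `b ≈ 1.14`).
HONEST FRAMING: bookkeeping about gradings of Tao-type MODEL lattice tables (route SubOnsagerCeiling, rung TL-M2Break); no stub, crux
or summit is proved and nothing here bears on Navier–Stokes regularity. [cite: Tao2016AveragedNS, §4 (4.2)–(4.3)]
-/

noncomputable section

-- the sub-problem namespace `NavierStokesRegularity.NavierStokesRegularity` is the tree's layout (D-0017)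
set_option linter.dupNamespace false

namespace Summit.NavierStokesRegularity.NavierStokesRegularity.Theorems

section GradingCycle

variable {α : Fin 4 → Fin 4 → Fin 4 → ℤ × ℤ × ℤ → ℝ}

/-- **Every feed-recurrent set of forward sources contains a primary mode.**  If `C` is a non-empty set of modes each of which
is a forward source fed (diagonally) by some member of `C` — e.g. a feed cycle `a₀ → a₁ → ⋯ → a_{p-1} → a₀` of any length, a
strongly connected component of the feed graph, a multi-reach pump/feed loop — then in EVERY grading `lev` satisfying the
structural clauses of the registered stubs some `c ∈ C` has `lev c = 0`: the member of minimal level cannot have a feeder of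
smaller level (clause (1)).  So `stub_primaryGraded{Large,Small}Ratio` assert, by name, the ν-uniform super-critical barrier on at
least one mode of every recurrent sub-network of every table — in particular on one mode of each reach loop of the numerics, whose
modes share one front exponent.  (`Theorems.kpNet_selfFeed_primary` of the companion file is the case `C = {a}`.) [this file] -/
theorem kpNet_recurrent_has_primary (lev : Fin 4 → ℕ)
    (hstruct : ∀ a, lev a ≠ 0 → (∃ e, α a a e (0, 0, 1) ≠ 0) →
      (∀ j, α j j a (0, 0, 1) ≠ 0 → lev j < lev a ∧ (lev j = 0 ∨ ∃ e', α j j e' (0, 0, 1) ≠ 0)) ∧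
      (∀ i₁ i₂, i₁ ≠ a → i₂ ≠ a → α i₁ i₂ a (0, 0, 0) ≠ 0 →
        (lev i₁ < lev a ∧ (lev i₁ = 0 ∨ ∃ e', α i₁ i₁ e' (0, 0, 1) ≠ 0)) ∧
        (lev i₂ < lev a ∧ (lev i₂ = 0 ∨ ∃ e', α i₂ i₂ e' (0, 0, 1) ≠ 0))) ∧
      (∃ e, α a a e (0, 0, 1) ≠ 0 ∧
        (∀ j, α e e j (0, 0, 1) ≠ 0 → lev j < lev a ∧ (lev j = 0 ∨ ∃ e', α j j e' (0, 0, 1) ≠ 0)) ∧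
        (∀ j, j ≠ e → α e e j (0, 0, 0) ≠ 0 →
          lev j < lev a ∧ (lev j = 0 ∨ ∃ e', α j j e' (0, 0, 1) ≠ 0))))
    (C : Finset (Fin 4)) (hC : C.Nonempty)
    (hsrc : ∀ c ∈ C, ∃ e, α c c e (0, 0, 1) ≠ 0)
    (hfed : ∀ c ∈ C, ∃ j ∈ C, α j j c (0, 0, 1) ≠ 0) :
    ∃ c ∈ C, lev c = 0 := by
  obtain ⟨c, hcC, hmin⟩ := Finset.exists_min_image C lev hC
  refine ⟨c, hcC, ?_⟩
  by_contra h
  obtain ⟨h1, _, _⟩ := hstruct c h (hsrc c hcC)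
  obtain ⟨j, hjC, hj⟩ := hfed c hcC
  exact absurd (hmin j hjC) (not_le.2 (h1 j hj).1)

/-- **A feed cycle of length three carries a primary mode** (the case `C = {a, b, c}` of `kpNet_recurrent_has_primary`):
`a → b → c → a` with non-zero diagonal feeds ⇒ `lev a = 0 ∨ lev b = 0 ∨ lev c = 0` in every structural grading.  (Unlike the
2-cycle, NOT every member need be primary: for the bare 3-cycle the grading `(lev a, lev b, lev c) = (2, 0, 1)` satisfies the
clauses.) [this file] -/
theorem kpNet_threeCycle_has_primary (lev : Fin 4 → ℕ)
    (hstruct : ∀ a, lev a ≠ 0 → (∃ e, α a a e (0, 0, 1) ≠ 0) →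
      (∀ j, α j j a (0, 0, 1) ≠ 0 → lev j < lev a ∧ (lev j = 0 ∨ ∃ e', α j j e' (0, 0, 1) ≠ 0)) ∧
      (∀ i₁ i₂, i₁ ≠ a → i₂ ≠ a → α i₁ i₂ a (0, 0, 0) ≠ 0 →
        (lev i₁ < lev a ∧ (lev i₁ = 0 ∨ ∃ e', α i₁ i₁ e' (0, 0, 1) ≠ 0)) ∧
        (lev i₂ < lev a ∧ (lev i₂ = 0 ∨ ∃ e', α i₂ i₂ e' (0, 0, 1) ≠ 0))) ∧
      (∃ e, α a a e (0, 0, 1) ≠ 0 ∧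
        (∀ j, α e e j (0, 0, 1) ≠ 0 → lev j < lev a ∧ (lev j = 0 ∨ ∃ e', α j j e' (0, 0, 1) ≠ 0)) ∧
        (∀ j, j ≠ e → α e e j (0, 0, 0) ≠ 0 →
          lev j < lev a ∧ (lev j = 0 ∨ ∃ e', α j j e' (0, 0, 1) ≠ 0))))
    {a b c : Fin 4} (hab : α a a b (0, 0, 1) ≠ 0) (hbc : α b b c (0, 0, 1) ≠ 0) (hca : α c c a (0, 0, 1) ≠ 0) :
    lev a = 0 ∨ lev b = 0 ∨ lev c = 0 := by
  have h := kpNet_recurrent_has_primary lev hstruct ({a, b, c} : Finset (Fin 4)) ⟨a, by simp⟩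
    (by
      intro x hx
      simp only [Finset.mem_insert, Finset.mem_singleton] at hx
      rcases hx with rfl | rfl | rfl
      exacts [⟨b, hab⟩, ⟨c, hbc⟩, ⟨a, hca⟩])
    (by
      intro x hx
      simp only [Finset.mem_insert, Finset.mem_singleton] at hx
      rcases hx with rfl | rfl | rfl
      · exact ⟨c, by simp, hca⟩
      · exact ⟨a, by simp, hab⟩
      · exact ⟨b, by simp, hbc⟩)
  obtain ⟨x, hx, hx0⟩ := h
  simp only [Finset.mem_insert, Finset.mem_singleton] at hx
  rcases hx with rfl | rfl | rfl
  · exact Or.inl hx0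
  · exact Or.inr (Or.inl hx0)
  · exact Or.inr (Or.inr hx0)

end GradingCycle

end Summit.NavierStokesRegularity.NavierStokesRegularity.Theorems

end
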